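import Mathlib.Analysis.SpecialFunctions.Pow.Real
import Mathlib.Algebra.Order.Floor.Defs
import HarnessLib

/-!
# [GenEll] Thm. 2.1 (ii) ⇒ (i) for `ℙ¹`: the order of the parameter choices

S. Mochizuki, *Arithmetic elliptic curves in general position*, Math. J. Okayama Univ. 52 (2010)
[cite: MochizukiGenEll2010, Thm 2.1 p.12], proof of Thm. 2.1, p. 12: "Here, we think of `e` as a fixed
number that will be chosen below … by choosing `e` to be sufficiently large, we may assume that
`deg(ω_X(D)|_Y) = deg(ω_Y(E)) ≤ (1+ε′)·deg(ω_Y)` … for some `ε′ ∈ ℝ_{>0}` such that `(1+ε′)² ≤ 1+ε`".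

For the `GenEllTwo` assembly (abc-iut cell, GENELLTWO-P1ROUTE W9; owner decision #5 (c)) the
quantifiers are ordered `ε → e → (cover, Belyi map, menu of cusp-preserving maps of maximal degree n)
→ ε″ → ε′`. This file proves the two elementary existence statements that order uses:

* `exists_odd_ramification_index` — for `ε > 0` there is an odd `e ≥ 5` with `e/(e−3) < 1+ε`
  (the margin `(e−3)/e` of the cover `D_e : r^e = x(1−x)`, `2g−2 = e−3`);
* `exists_eps_of_transfer_loss` — for `ε > 0` and a degree bound `n ≥ 1` there is `ε″ > 0` with
  `0 < 1 − ε″(n−1)` and `(1+ε″)/(1 − ε″(n−1)) ≤ 1+ε` (the loss of the transfer along a cusp-preserving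
  Belyi map of degree `≤ n`, [GenEll] p. 13 with `E ⊋ D`).

Theorems only; no definitions, no named facts.
-/

namespace Literature.NumberTheory.DiophantineGeometry.GenEll

/-- **Choice of the ramification index `e`**: for every `ε > 0` there is an odd integer `e ≥ 5` with
`e/(e−3) < 1 + ε`, equivalently `1/((e−3)/e) < 1+ε` — "by choosing `e` to be sufficiently large".
[cite: MochizukiGenEll2010, Thm 2.1 p.12] -/
theorem exists_odd_ramification_index {ε : ℝ} (hε : 0 < ε) :
    ∃ e : ℕ, Odd e ∧ 5 ≤ e ∧ (e : ℝ) / ((e : ℝ) - 3) < 1 + ε := by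
  -- `e = 2m + 5` with `m > 3/(2ε)`: then `e − 3 = 2m + 2 > 3/ε`, so `e/(e−3) = 1 + 3/(e−3) < 1 + ε`
  obtain ⟨m, hm⟩ := exists_nat_gt (3 / (2 * ε))
  refine ⟨2 * m + 5, ⟨m + 2, by ring⟩, by omega, ?_⟩
  have hpos : (0 : ℝ) < ((2 * m + 5 : ℕ) : ℝ) - 3 := by push_cast; linarith
  rw [div_lt_iff₀ hpos]
  push_cast
  have h1 : 3 < 2 * ε * (m : ℝ) := by
    have := (div_lt_iff₀ (by positivity : (0 : ℝ) < 2 * ε)).mp hm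
    linarith
  nlinarith

/-- **Choice of `ε″` against the transfer loss**: for `ε > 0` and `n ≥ 1` there is `ε″ > 0` with
`0 < 1 − ε″·(n−1)` and `(1+ε″)/(1 − ε″(n−1)) ≤ 1 + ε` (pull-back of Vojta's inequality along a
cusp-preserving Belyi map of degree `≤ n` costs the factor `(1+ε″)/(1−ε″(n−1))`).
[cite: MochizukiGenEll2010, Thm 2.1 p.13] -/
theorem exists_eps_of_transfer_loss {ε : ℝ} (hε : 0 < ε) {n : ℕ} (hn : 1 ≤ n) :
    ∃ ε'' : ℝ, 0 < ε'' ∧ 0 < 1 - ε'' * ((n : ℝ) - 1) ∧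
      (1 + ε'') / (1 - ε'' * ((n : ℝ) - 1)) ≤ 1 + ε := by
  -- ε″ := ε / (2 (1+ε) n): then ε″(n−1) ≤ ε/(2(1+ε)) < 1/2 and (1+ε″) ≤ (1+ε)(1 − ε″(n−1))
  have hn0 : (0 : ℝ) ≤ (n : ℝ) - 1 := by
    have : (1 : ℝ) ≤ n := by exact_mod_cast hn
    linarith
  have hn1 : (0 : ℝ) < n := by exact_mod_cast hn
  set ε'' : ℝ := ε / (2 * (1 + ε) * n) with hε''
  have hε''pos : 0 < ε'' := by positivity
  have hprod : ε'' * ((n : ℝ) - 1) ≤ ε / (2 * (1 + ε)) := by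
    rw [hε'']
    rw [div_mul_eq_mul_div, div_le_div_iff₀ (by positivity) (by positivity)]
    nlinarith
  have hhalf : ε / (2 * (1 + ε)) < 1 / 2 := by
    rw [div_lt_div_iff₀ (by positivity) (by positivity)]
    nlinarith
  have hden : 0 < 1 - ε'' * ((n : ℝ) - 1) := by linarith
  refine ⟨ε'', hε''pos, hden, ?_⟩
  rw [div_le_iff₀ hden]
  -- (1+ε)(1 − ε″(n−1)) ≥ (1+ε)(1 − ε/(2(1+ε))) = 1 + ε − ε/2 = 1 + ε/2 ≥ 1 + ε″
  have h1 : (1 + ε) * (1 - ε'' * ((n : ℝ) - 1)) ≥ (1 + ε) * (1 - ε / (2 * (1 + ε))) := by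
    apply mul_le_mul_of_nonneg_left _ (by linarith)
    linarith
  have h2 : (1 + ε) * (1 - ε / (2 * (1 + ε))) = 1 + ε / 2 := by
    field_simp
    ring
  have h3 : ε'' ≤ ε / 2 := by
    have hn1' : (1 : ℝ) ≤ n := by exact_mod_cast hn
    have hprod1 : (1 : ℝ) ≤ (1 + ε) * n := one_le_mul_of_one_le_of_one_le (by linarith) hn1'
    rw [hε'', div_le_div_iff₀ (by positivity) (by positivity)]
    have : ε * 2 ≤ ε * (2 * (1 + ε) * (n : ℝ)) :=
      mul_le_mul_of_nonneg_left (by nlinarith) hε.le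
    linarith
  linarith

end Literature.NumberTheory.DiophantineGeometry.GenEll
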